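import Literature.MathematicalPhysics.QuantumFieldTheory.Balaban1983to89.T4AveragingDeficitWallBoundary
import Literature.MathematicalPhysics.QuantumFieldTheory.Balaban1983to89.T4Continuum
import Literature.MathematicalPhysics.QuantumFieldTheory.Balaban1983to89.UnitaryModel

/-!
# SUBSTRATE — VOCABULARY V1 ↔ V3, part 1 (carriers): torus gauge fields of record (`Setup.GaugeField` on the `ZMod` torus) read as
# PERIODIC configurations on `ℤ^d` (`B7Prop1Explicit.Site d → Fin d → H`, row NE3's vocabulary); sites, words and parallel
# transport, plaquettes, and the small-field class

Cell `pub-balaban`, SUBSTRATE cell, seat `b2b-balaban-substrate-p2`; registry item S-VOC-2 of `substrate/STATUS.md` §2 (MAP v0.2 §4 p2 (3),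
[dict] line D-3: «so that NE3's theorems are consumed BY NAME on `DrivenRuns`»), PART 1 = the carrier-level dictionary.  Summits-side
bookkeeping; imports `T4AveragingDeficitWallBoundary` (V3: `IsPeriodicCfg`; through it `T4AveragingDeficitWall`'s `IsUnitaryCfg` ∕
`SmallField` and `B7Prop1Explicit`'s sites, words, `hol`) and `T4Continuum` (V1: `walk`, `holAt`) BY NAME; edits nothing.

HONEST FRAMING (T4-DAG p. 1).  Rung (B)+1 of the FINITE-VOLUME T⁴ continuum programme — NOT infinite volume, NOT a mass gap, NOT the
Clay problem, NOT summit progress, no estimate; a DICTIONARY (identities only).  HONEST DEPENDENCY (cell line, verbatim): continuum YM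
on T⁴ ⇐ BetaPertH ∧ nine spine estimates (0/9 proved); BetaPertH ⇐ (D1) ∧ (D4) ∧ CAP+tail; G-an2-4 gates asym, D1 and NE2/3/4.

THE TWO VOCABULARIES.  V1 (of record: `Setup`, `B13Carriers`, `SubstrateTwoRunsDriven`): sites `Site P j = Fin d → ZMod (N_j)`,
`N_j = P.sitesPerDir j`, gauge fields `GaugeField P j G = PBond P j → G`, oriented walks `T4Continuum.walk x w` and holonomies
`T4Continuum.holAt`, plaquettes `Setup.Plaq` (`μ < ν`) with `GaugeField.plaqHol`.  V3 (row NE3: `B7Prop1Explicit`, `T4AveragingDeficitWall*`,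
`MinimalAction*`): the lattice `ℤ^d` (`B7Prop1Explicit.Site d = Fin d → ℤ`), configurations `Site d → Fin d → H` PERIODIC of period `N`
(`IsPeriodicCfg`), parallel transport `B7Prop1Explicit.hol V x w` along words of letters `Fin d × Bool` (the SAME letter type as V1's
`T4Continuum.Letter`), plaquette words `plaqWord κ κ′`, `SmallField V a` (`‖V(∂p) − 1‖ ≤ a` for all plaquette words), `IsUnitaryCfg`.
* §1 `toZMod j : (Fin d → ℤ) → Site P j` (coordinatewise reduction), `toZMod_add_e` ∕ `toZMod_sub_e` (= `Site.shift` ∕ `Site.unshift`),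
  `toZMod_add_period` (period `N_j`), `toZMod_surjective`.
* §2 **`liftCfg ι U`** — the V1 field `U` read as a V3 configuration through a group morphism `ι : G →* H` (for `G = U(n)`: `Unitary.toUnits`):
  `liftCfg ι U x κ = ι (U ⟨toZMod x, κ⟩)`; periodicity `liftCfg_add_period`, **`isPeriodicCfg_liftCfg`** (matrix units), **`isUnitaryCfg_liftCfg`**
  (when `ι` lands in the unitary units; for `G = U(n)`: `isUnitaryCfg_liftCfg_toUnits` (§7) — when instantiating by hand name
  `(G := Matrix.unitaryGroup n ℂ)` FIRST, see R-ne9leaf02g7-1: the bare `isUnitaryCfg_liftCfg Unitary.toUnits …` does not elaborate).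
* §3 **`hol_liftCfg`**: V3 parallel transport of the lift along ANY word = `ι` of V1's holonomy along the walk it spells:
  `hol (liftCfg ι U) x w = ι (holAt U (walk (toZMod x) w))`.
* §4 plaquettes: `holAt_walk_plaqWord_of_lt` (V1: the walk of `plaqWord μ ν`, `μ < ν`, has holonomy `plaqHol U ⟨x, μ, ν⟩`) and `…_of_gt`
  (`ν < μ`: the inverse of `plaqHol U ⟨x, ν, μ⟩`), hence `hol_liftCfg_plaqWord_of_lt ∕ _of_gt` and **`smallField_liftCfg_iff`**:
  `SmallField (liftCfg ι U) a ↔ ∀ p : Plaq P j, ‖ι(U(∂p)) − 1‖ ≤ a ∧ ‖ι(U(∂p))⁻¹ − 1‖ ≤ a` — V3's small-field class of the lift read on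
  V1's plaquette variables (both orientations).
NOT IN PART 1 (typed for part 2 ∕ the typer's v0.3): the AVERAGING correspondence `BlockAveraging.blockAvg ℰ ↔ B7Prop1Explicit.bavg`
(needs the exp–log small-loop average as a `LoopAverage` and the reconciliation of the CENTRED block convention of `Setup.Site.blockOf`
with B7's CORNER convention — `AveragingRT`'s docstring), the level re-indexing V1 level `j` ↔ V3 period `N·L^k`, and
`IsBackground ↔ MinimalActionSandwich.IsMinimiser`.
* §5 (v1.1, APPENDED): `smallField_liftCfg_of_plaqSmall` — `PlaqSmall δ U ⇒ SmallField (liftCfg ι U) (c·δ)` under `‖ι g − 1‖ ≤ c·dist1 g`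
  (the typer's `SmallFieldDict ι c`, sketch v0.3 §V3, DISCHARGED); `norm_toUnits_sub_one` (`c = 1`, equality, for `U(n)`),
  `smallField_liftCfg_toUnits_of_plaqSmall`.
* §6 (v1.2, APPENDED): `Wcx_liftCfg`, `bavg_liftCfg` — B7's (42) loop variables and average of the lift READ on V1 holonomies (no
  identification with the (0.4) family claimed).
* §7 (v1.3, APPENDED; R-ne9leaf02g7-1): `liftU`, `isUnitaryCfg_liftCfg_toUnits`, `isPeriodicCfg_liftCfg_toUnits`, `smallField_liftU_iff` —
  the `U(n)` specialisations with `G` named once.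
No estimate, no `def … : Prop`, no `sorry`.

References (KIND only): [Balaban1985Averaging] (9) p. 18 (parallel transport), (44) p. 24 (small fields); [Balaban1987RG1] (0.1) p. 252
(the torus and its integer labels).
-/

noncomputable section

open scoped BigOperators Matrix.Norms.L2Operator

namespace Summit.QuantumFields.BalabanUV.T4Continuum.SubstrateVocabularyV3

open Literature.MathematicalPhysics.QuantumFieldTheory.Balaban1983to89
open Literature.MathematicalPhysics.QuantumFieldTheory.Balaban1983to89.B7Prop1Explicit (e e_apply hol hol_nil hol_cons stepHol
  stepHol_true stepHol_false plaqWord)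
open Literature.MathematicalPhysics.QuantumFieldTheory.Balaban1983to89.B7Prop2Explicit (unitaryUnits mem_unitaryUnits)
open Literature.MathematicalPhysics.QuantumFieldTheory.Balaban1983to89.T4AveragingDeficitWall (IsUnitaryCfg SmallField)
open Literature.MathematicalPhysics.QuantumFieldTheory.Balaban1983to89.T4AveragingDeficitWallBoundary (IsPeriodicCfg)
open Literature.MathematicalPhysics.QuantumFieldTheory.Balaban1983to89.T4Continuum (walk holAt LStep holAt_cons)

variable {P : Params} {j : ℕ}

/-! ## §1 Sites: `ℤ^d → (ZMod N_j)^d` -/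

/-- [folklore] THE REDUCTION OF INTEGER LABELS to the level-`j` torus of record (coordinatewise `ℤ → ZMod N_j`, `N_j = P.sitesPerDir j`;
[Balaban1987RG1] (0.1): the torus sites are integer labels modulo the period). -/
def toZMod (j : ℕ) (x : B7Prop1Explicit.Site P.d) : Site P j := fun μ => ((x μ : ℤ) : ZMod (P.sitesPerDir j))

/-- [folklore] `toZMod` coordinatewise. -/
@[simp] theorem toZMod_apply (x : B7Prop1Explicit.Site P.d) (μ : Fin P.d) :
    toZMod (P := P) j x μ = ((x μ : ℤ) : ZMod (P.sitesPerDir j)) := rfl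

/-- [folklore] A STEP `+e_μ` on `ℤ^d` is the torus shift: `toZMod (x + e_μ) = (toZMod x).shift μ`. -/
theorem toZMod_add_e (x : B7Prop1Explicit.Site P.d) (μ : Fin P.d) : toZMod (P := P) j (x + e μ) = (toZMod j x).shift μ := by
  funext ν
  rw [Site.shift_apply, toZMod_apply, toZMod_apply, Pi.add_apply, e_apply]
  by_cases h : ν = μ
  · simp [h]
  · simp [h]

/-- [folklore] A STEP `−e_μ` on `ℤ^d` is the torus unshift: `toZMod (x − e_μ) = (toZMod x).unshift μ`. -/
theorem toZMod_sub_e (x : B7Prop1Explicit.Site P.d) (μ : Fin P.d) : toZMod (P := P) j (x - e μ) = (toZMod j x).unshift μ := by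
  funext ν
  rw [Site.unshift_apply, toZMod_apply, toZMod_apply, Pi.sub_apply, e_apply]
  by_cases h : ν = μ
  · simp [h]
  · simp [h]

/-- [folklore] `toZMod (x + (−e_μ)) = (toZMod x).unshift μ` (the form the V3 transport recursion produces). -/
theorem toZMod_add_neg_e (x : B7Prop1Explicit.Site P.d) (μ : Fin P.d) :
    toZMod (P := P) j (x + -e μ) = (toZMod j x).unshift μ := by
  rw [← sub_eq_add_neg]; exact toZMod_sub_e x μ

/-- [folklore] **PERIODICITY**: a translation by the period `N_j` in a lattice direction does not change the torus site. -/
theorem toZMod_add_period (x : B7Prop1Explicit.Site P.d) (κ : Fin P.d) :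
    toZMod (P := P) j (x + (P.sitesPerDir j : ℤ) • e κ) = toZMod j x := by
  funext ν
  rw [toZMod_apply, toZMod_apply, Pi.add_apply, Pi.smul_apply, e_apply]
  by_cases h : ν = κ
  · simp [h]
  · simp [h]

/-- [folklore] Every torus site is the reduction of an integer label (its canonical representative). -/
theorem toZMod_surjective (j : ℕ) : Function.Surjective (toZMod (P := P) j) := fun y =>
  ⟨fun μ => ((y μ).val : ℤ), funext fun μ => by simp⟩

/-! ## §2 Gauge fields of record as periodic configurations on `ℤ^d` -/

section Lift

variable {G : Type*} [GaugeGroup G] {H : Type*} [Group H]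

/-- [folklore] **THE LIFT** of a level-`j` gauge field of record to a configuration on `ℤ^d`, through a group morphism `ι : G →* H`
(`H = (Matrix n n ℂ)ˣ` for row NE3's vocabulary): `liftCfg ι U x κ = ι (U ⟨toZMod x, κ⟩)`. -/
def liftCfg (ι : G →* H) (U : GaugeField P j G) : B7Prop1Explicit.Site P.d → Fin P.d → H := fun x κ => ι (U ⟨toZMod j x, κ⟩)

/-- [folklore] `liftCfg` unfolded. -/
@[simp] theorem liftCfg_apply (ι : G →* H) (U : GaugeField P j G) (x : B7Prop1Explicit.Site P.d) (κ : Fin P.d) :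
    liftCfg ι U x κ = ι (U ⟨toZMod j x, κ⟩) := rfl

/-- [folklore] **THE LIFT IS PERIODIC** of period `N_j` in every lattice direction. -/
theorem liftCfg_add_period (ι : G →* H) (U : GaugeField P j G) (x : B7Prop1Explicit.Site P.d) (κ μ : Fin P.d) :
    liftCfg ι U (x + (P.sitesPerDir j : ℤ) • e κ) μ = liftCfg ι U x μ := by
  rw [liftCfg_apply, liftCfg_apply, toZMod_add_period]

/-- [folklore] The lift depends on `x` only through `toZMod x`. -/
theorem liftCfg_eq_of_toZMod_eq (ι : G →* H) (U : GaugeField P j G) {x x' : B7Prop1Explicit.Site P.d}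
    (h : toZMod (P := P) j x = toZMod j x') : liftCfg ι U x = liftCfg ι U x' := by
  funext κ
  rw [liftCfg_apply, liftCfg_apply, h]

end Lift

section Matrix

variable {G : Type*} [GaugeGroup G] {n : Type*} [Fintype n] [DecidableEq n]

/-- [folklore] **`IsPeriodicCfg` FOR THE LIFT** (row NE3's periodicity predicate, matrix-unit-valued configurations): period `N_j`. -/
theorem isPeriodicCfg_liftCfg (ι : G →* (Matrix n n ℂ)ˣ) (U : GaugeField P j G) :
    IsPeriodicCfg (liftCfg ι U) (P.sitesPerDir j : ℤ) :=
  fun x κ μ => liftCfg_add_period ι U x κ μ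

/-- [folklore] **`IsUnitaryCfg` FOR THE LIFT** through a morphism with values in the unitary units. -/
theorem isUnitaryCfg_liftCfg (ι : G →* (Matrix n n ℂ)ˣ) (hι : ∀ g, ι g ∈ unitaryUnits (Matrix n n ℂ)) (U : GaugeField P j G) :
    IsUnitaryCfg (liftCfg ι U) :=
  fun _ _ => hι _

/-- [folklore] The units morphism of `U(n) = Matrix.unitaryGroup n ℂ` (Mathlib's `Unitary.toUnits`) lands in the unitary units. -/
theorem toUnits_mem_unitaryUnits (g : Matrix.unitaryGroup n ℂ) : Unitary.toUnits g ∈ unitaryUnits (Matrix n n ℂ) := by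
  rw [mem_unitaryUnits]
  exact g.2

end Matrix

/-! ## §3 Parallel transport: V3's `hol` of the lift = V1's `holAt` along the walk -/

section Transport

variable {G : Type*} [GaugeGroup G] {H : Type*} [Group H]

/-- [folklore] V1's holonomy along the walk of a word starting with `+e_μ`. -/
theorem holAt_walk_cons_true (U : GaugeField P j G) (y : Site P j) (μ : Fin P.d) (w : List (T4Continuum.Letter P.d)) :
    holAt U (walk y ((μ, true) :: w)) = U ⟨y, μ⟩ * holAt U (walk (y.shift μ) w) := by
  simp [walk, holAt]

/-- [folklore] V1's holonomy along the walk of a word starting with `−e_μ`. -/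
theorem holAt_walk_cons_false (U : GaugeField P j G) (y : Site P j) (μ : Fin P.d) (w : List (T4Continuum.Letter P.d)) :
    holAt U (walk y ((μ, false) :: w)) = (U ⟨y.unshift μ, μ⟩)⁻¹ * holAt U (walk (y.unshift μ) w) := by
  simp [walk, holAt]

/-- [folklore] **PARALLEL TRANSPORT DICTIONARY**: for every word `w` and base label `x`, V3's transport of the lifted configuration is
`ι` of V1's holonomy along the walk `w` spells from `toZMod x` ([Balaban1985Averaging] (9): `U(Γ) = U(b₁)⋯U(b_n)`, `U(−b) = U(b)⁻¹`,
in both vocabularies). -/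
theorem hol_liftCfg (ι : G →* H) (U : GaugeField P j G) :
    ∀ (x : B7Prop1Explicit.Site P.d) (w : List (B7Prop1Explicit.Letter P.d)),
      hol (liftCfg ι U) x w = ι (holAt U (walk (toZMod j x) w))
  | x, [] => by simp [holAt, walk]
  | x, (μ, true) :: w => by
    rw [hol_cons, stepHol_true, B7Prop1Explicit.Letter.vec_true, hol_liftCfg ι U (x + e μ) w, toZMod_add_e,
      holAt_walk_cons_true, map_mul, liftCfg_apply]
  | x, (μ, false) :: w => by
    rw [hol_cons, B7Prop1Explicit.Letter.vec_false, hol_liftCfg ι U (x + -e μ) w, toZMod_add_neg_e, stepHol_false,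
      liftCfg_apply, toZMod_sub_e, holAt_walk_cons_false, map_mul, map_inv]

end Transport

/-! ## §4 Plaquettes and the small-field class -/

section Plaquettes

variable {G : Type*} [GaugeGroup G]

/-- [folklore] **THE PLAQUETTE WALK, positive orientation**: the walk spelled by `plaqWord μ ν` (`μ < ν`) from `y` has holonomy the
plaquette variable `U(∂p)`, `p = ⟨y, μ, ν⟩` ([Balaban1985Averaging] (44): `∂p`; `Setup.GaugeField.plaqHol`). -/
theorem holAt_walk_plaqWord_of_lt (U : GaugeField P j G) (y : Site P j) {μ ν : Fin P.d} (h : μ < ν) :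
    holAt U (walk y (plaqWord μ ν)) = GaugeField.plaqHol U ⟨y, μ, ν, h⟩ := by
  simp only [plaqWord, walk, holAt, List.map_cons, List.map_nil, List.prod_cons, List.prod_nil, mul_one, if_true,
    Bool.false_eq_true, if_false, T4ReflectionCone.shift_shift_unshift, T4ReflectionCone.shift_unshift, GaugeField.plaqHol, mul_assoc]

/-- [folklore] **THE PLAQUETTE WALK, negative orientation**: for `ν < μ` the walk of `plaqWord μ ν` traverses the plaquette `⟨y, ν, μ⟩`
backwards: holonomy `U(∂p)⁻¹`. -/
theorem holAt_walk_plaqWord_of_gt (U : GaugeField P j G) (y : Site P j) {μ ν : Fin P.d} (h : ν < μ) :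
    holAt U (walk y (plaqWord μ ν)) = (GaugeField.plaqHol U ⟨y, ν, μ, h⟩)⁻¹ := by
  simp only [plaqWord, walk, holAt, List.map_cons, List.map_nil, List.prod_cons, List.prod_nil, mul_one, if_true,
    Bool.false_eq_true, if_false, T4ReflectionCone.shift_shift_unshift, T4ReflectionCone.shift_unshift, GaugeField.plaqHol, mul_inv_rev, inv_inv, mul_assoc]

variable {H : Type*} [Group H]

/-- [folklore] V3's plaquette transport of the lift, positive orientation. -/
theorem hol_liftCfg_plaqWord_of_lt (ι : G →* H) (U : GaugeField P j G) (x : B7Prop1Explicit.Site P.d) {μ ν : Fin P.d} (h : μ < ν) :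
    hol (liftCfg ι U) x (plaqWord μ ν) = ι (GaugeField.plaqHol U ⟨toZMod j x, μ, ν, h⟩) := by
  rw [hol_liftCfg, holAt_walk_plaqWord_of_lt]

/-- [folklore] V3's plaquette transport of the lift, negative orientation. -/
theorem hol_liftCfg_plaqWord_of_gt (ι : G →* H) (U : GaugeField P j G) (x : B7Prop1Explicit.Site P.d) {μ ν : Fin P.d} (h : ν < μ) :
    hol (liftCfg ι U) x (plaqWord μ ν) = (ι (GaugeField.plaqHol U ⟨toZMod j x, ν, μ, h⟩))⁻¹ := by
  rw [hol_liftCfg, holAt_walk_plaqWord_of_gt, map_inv]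

end Plaquettes

section Small

variable {G : Type*} [GaugeGroup G] {n : Type*} [Fintype n] [DecidableEq n]

/-- [folklore] **THE SMALL-FIELD CLASS OF THE LIFT READ ON THE PLAQUETTE VARIABLES OF RECORD**: `SmallField (liftCfg ι U) a` (V3: every
plaquette WORD, both orientations, from every integer label) iff every plaquette variable of record and its inverse are within `a` of
`1` after `ι` ([Balaban1985Averaging] (44) read in both vocabularies; no norm identity is used — the two orientations are kept). -/
theorem smallField_liftCfg_iff (ι : G →* (Matrix n n ℂ)ˣ) (U : GaugeField P j G) (a : ℝ) :
    SmallField (liftCfg ι U) a ↔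
      ∀ p : Plaq P j, ‖((ι (GaugeField.plaqHol U p) : (Matrix n n ℂ)ˣ) : Matrix n n ℂ) - 1‖ ≤ a ∧
        ‖(((ι (GaugeField.plaqHol U p))⁻¹ : (Matrix n n ℂ)ˣ) : Matrix n n ℂ) - 1‖ ≤ a := by
  constructor
  · intro h p
    obtain ⟨x, hx⟩ := toZMod_surjective (P := P) j p.src
    have h1 := h x p.μ p.ν (ne_of_lt p.hμν)
    have h2 := h x p.ν p.μ (ne_of_gt p.hμν)
    rw [hol_liftCfg_plaqWord_of_lt ι U x p.hμν, hx] at h1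
    rw [hol_liftCfg_plaqWord_of_gt ι U x p.hμν, hx] at h2
    exact ⟨h1, h2⟩
  · intro h x κ κ' hκ
    rcases lt_or_gt_of_ne hκ with hlt | hgt
    · rw [hol_liftCfg_plaqWord_of_lt ι U x hlt]
      exact (h ⟨toZMod j x, κ, κ', hlt⟩).1
    · rw [hol_liftCfg_plaqWord_of_gt ι U x hgt]
      exact (h ⟨toZMod j x, κ', κ, hgt⟩).2

end Small

/-! ## §5 (v1.1, appended) The small-field class of record transfers to V3's — sketch v0.3 §V3 `SmallFieldDict`, discharged -/

section SmallTransfer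

variable {G : Type*} [GaugeGroup G] {n : Type*} [Fintype n] [DecidableEq n]

/-- [folklore] **`PlaqSmall δ U ⇒ SmallField (liftCfg ι U) (c·δ)`** for a morphism whose values are norm-controlled by the distance of
record, `‖ι g − 1‖ ≤ c · dist1 g` (displayed; `c = 1` with equality for `U(n)`, `norm_toUnits_sub_one`): the typer's hypothesis shape
`SmallFieldDict ι c` (sketch v0.3 §V3) holds for every such `ι` — both orientations via `dist1 g⁻¹ = dist1 g`. -/
theorem smallField_liftCfg_of_plaqSmall (ι : G →* (Matrix n n ℂ)ˣ) {c : ℝ} (hc : 0 ≤ c)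
    (hι : ∀ g, ‖((ι g : (Matrix n n ℂ)ˣ) : Matrix n n ℂ) - 1‖ ≤ c * dist1 g) {δ : ℝ} {U : GaugeField P j G}
    (hU : PlaqSmall δ U) : SmallField (liftCfg ι U) (c * δ) := by
  rw [smallField_liftCfg_iff]
  intro p
  have hp := hU p
  refine ⟨(hι _).trans (mul_le_mul_of_nonneg_left hp.le hc), ?_⟩
  rw [← map_inv]
  refine (hι _).trans ?_
  rw [GaugeGroup.dist1_inv]
  exact mul_le_mul_of_nonneg_left hp.le hc

variable [Nonempty n] in
/-- [folklore] For `G = U(n)` and `ι = Unitary.toUnits` the control is an EQUALITY with `c = 1`: `‖ι g − 1‖ = dist1 g` (`rfl`: both are the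
`L²`-operator norm of `g − 1`, `UnitaryModel.instGaugeGroupUnitaryGroup`). -/
theorem norm_toUnits_sub_one (g : Matrix.unitaryGroup n ℂ) :
    ‖((Unitary.toUnits g : (Matrix n n ℂ)ˣ) : Matrix n n ℂ) - 1‖ = dist1 g := rfl

variable [Nonempty n] in
/-- [folklore] **`U(n)` of record**: `PlaqSmall δ U ⇒ SmallField (liftCfg Unitary.toUnits U) δ`. -/
theorem smallField_liftCfg_toUnits_of_plaqSmall {δ : ℝ} {U : GaugeField P j (Matrix.unitaryGroup n ℂ)} (hU : PlaqSmall δ U) :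
    SmallField (liftCfg (G := Matrix.unitaryGroup n ℂ) (Unitary.toUnits : Matrix.unitaryGroup n ℂ →* (Matrix n n ℂ)ˣ) U) δ := by
  have h := smallField_liftCfg_of_plaqSmall (P := P) (j := j) (G := Matrix.unitaryGroup n ℂ)
    (Unitary.toUnits : Matrix.unitaryGroup n ℂ →* (Matrix n n ℂ)ˣ) zero_le_one (fun g => by rw [norm_toUnits_sub_one, one_mul]) hU
  rwa [one_mul] at h

end SmallTransfer

/-! ## §6 (v1.2, appended) B7's (42) loop variables and average READ ON V1 HOLONOMIES (typer NEXT gen 4 task 3(b), the cheap half: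
no identification with the (0.4) family `BlockAveraging.loopHol` is claimed — journal finding F-SUB-p2-1 ∕ ruling Q-S9′) -/

section LoopsB7

open Literature.MathematicalPhysics.QuantumFieldTheory.Balaban1983to89.B7Prop1Explicit (Wcx Wcx_eq_hol_loop Xavg bavg gammaWord seg)

variable {G : Type*} [GaugeGroup G] {n : Type*} [Fintype n] [DecidableEq n]

/-- [folklore] **(42)'s LOOP VARIABLE `V(Γ_{c,x}) V(c)⁻¹` OF THE LIFT** is `ι` of V1's holonomy along the closed word
`Γ_{c,x} ∪ (−Γ_c)` from `toZMod q` ([Balaban1985Averaging] (42); `Wcx_eq_hol_loop` + `hol_liftCfg`). -/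
theorem Wcx_liftCfg (L : ℕ) (ι : G →* (Matrix n n ℂ)ˣ) (U : GaugeField P j G) (q : B7Prop1Explicit.Site P.d) (κ : Fin P.d)
    (r : B7Prop1Explicit.Site P.d) :
    Wcx L (liftCfg ι U) q κ r = ι (holAt U (walk (toZMod j q) (gammaWord L κ r ++ seg κ (-(L : ℤ))))) := by
  rw [Wcx_eq_hol_loop, hol_liftCfg]

/-- [folklore] **(42)'s AVERAGE OF THE LIFT READ ON V1**: `bavg L (liftCfg ι U) q κ = exp[Σ_r L^{−d} log ι(U(loop_r))] · ι(U(Γ_c))` with every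
holonomy a V1 `holAt` along a walk from `toZMod q`. -/
theorem bavg_liftCfg [Nonempty n] (L : ℕ) (ι : G →* (Matrix n n ℂ)ˣ) (U : GaugeField P j G) (q : B7Prop1Explicit.Site P.d) (κ : Fin P.d) :
    bavg L (liftCfg ι U) q κ =
      B7Prop1Explicit.expUnit (∑ r : Fin P.d → Fin L, (((L : ℝ) ^ P.d)⁻¹) •
          MatrixLog.mlog ((ι (holAt U (walk (toZMod j q) (gammaWord L κ (B7Prop1Explicit.boxVec L r) ++ seg κ (-(L : ℤ))))) :
            (Matrix n n ℂ)ˣ) : Matrix n n ℂ)) *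
        ι (holAt U (walk (toZMod j q) (seg κ L))) := by
  unfold bavg Xavg
  simp only [Wcx_liftCfg, hol_liftCfg]

end LoopsB7

/-! ## §7 (v1.3, appended) The `U(n)` specialisations packaged (located usability remark R-ne9leaf02g7-1, ne9-formalise-leaf-02-g7, journal
l.1393x: with `G` left implicit, `Unitary.toUnits : unitary ?R →* ?Rˣ` is solved from the units side and the instance-defeq check against
`Matrix.unitaryGroup n ℂ := unitary (Matrix n n ℂ)` does not terminate; naming `G` first cures it — done once here) -/

section UnitaryPackaged

variable {n : Type*} [Fintype n] [DecidableEq n] [Nonempty n]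

/-- [folklore] THE LIFT OF A `U(n)`-VALUED FIELD OF RECORD through `Unitary.toUnits` (with `G` named, R-ne9leaf02g7-1). -/
abbrev liftU (U : GaugeField P j (Matrix.unitaryGroup n ℂ)) : B7Prop1Explicit.Site P.d → Fin P.d → (Matrix n n ℂ)ˣ :=
  liftCfg (G := Matrix.unitaryGroup n ℂ) (Unitary.toUnits : Matrix.unitaryGroup n ℂ →* (Matrix n n ℂ)ˣ) U

/-- [folklore] **`U(n)`: the lift is a `U(N)`-valued configuration** in row NE3's sense (reader's probe (Q1′), instant). -/
theorem isUnitaryCfg_liftCfg_toUnits (U : GaugeField P j (Matrix.unitaryGroup n ℂ)) : IsUnitaryCfg (liftU U) :=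
  fun _ _ => toUnits_mem_unitaryUnits _

/-- [folklore] **`U(n)`: the lift is `N_j`-periodic**. -/
theorem isPeriodicCfg_liftCfg_toUnits (U : GaugeField P j (Matrix.unitaryGroup n ℂ)) : IsPeriodicCfg (liftU U) (P.sitesPerDir j : ℤ) :=
  isPeriodicCfg_liftCfg (G := Matrix.unitaryGroup n ℂ) _ U

/-- [folklore] **`U(n)`: V3's small-field class of the lift read on the plaquette variables of record** (the exact iff at `ι = toUnits`). -/
theorem smallField_liftU_iff (U : GaugeField P j (Matrix.unitaryGroup n ℂ)) (a : ℝ) :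
    SmallField (liftU U) a ↔
      ∀ p : Plaq P j, ‖((GaugeField.plaqHol U p : Matrix.unitaryGroup n ℂ) : Matrix n n ℂ) - 1‖ ≤ a ∧
        ‖(((GaugeField.plaqHol U p)⁻¹ : Matrix.unitaryGroup n ℂ) : Matrix n n ℂ) - 1‖ ≤ a := by
  rw [liftU, smallField_liftCfg_iff (G := Matrix.unitaryGroup n ℂ)]
  simp only [← map_inv]
  rfl

end UnitaryPackaged

end Summit.QuantumFields.BalabanUV.T4Continuum.SubstrateVocabularyV3

end
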